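import Summits.QuantumFields.YangMills.Theses.CertificationLength
import HarnessLib

/-!
# Route `CertificationLength`, support `CertificationLengthDiverges` (stmt-QuantumFields-16181) — REFUTED AS TYPED (misstated)

The item quantifies over ALL compact topological groups `G` (no `IsCompactSimpleLieGroup G →` binder).  For the trivial group
`G = PUnit` (faithful `0`-dimensional unitary representation) the configuration space `LGConfig 4 PUnit` is a singleton, so any two
exterior conditions `η, η'` coincide, the two conditional Wilson laws are the same measure, and the total-variation finite-size
condition holds with `ε = 0` at every scale `b` and every `β`; the item's conclusion `¬ (finite-size condition)` therefore fails at
`n = 1, ε = 0, B = 1, b = 1`.  This is exactly the flag recorded at the item's birth (planner skeleton card, 2026-08-17): class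
MISSTATED; the repaired statement adds the binder `IsCompactSimpleLieGroup G →` after `[CompactSpace G]` (the witness below misses it:
`PUnit` is abelian, hence not `IsSimpleCompactGroup`).

Free-hands work of seat `ym-line-fcl-p3` g14.  THEOREMS ONLY (no `def`, no `sorry`); no summit / leaf statement is touched.
-/

set_option autoImplicit false

noncomputable section

open MeasureTheory
open Literature.MathematicalPhysics.QuantumFieldTheory

namespace Summit.QuantumFields.YangMills.Theorems.CertificationLength

/-- **refuted-misstated.** `¬ CertificationLengthDiverges`: witness `G = PUnit` with its faithful `0`-dimensional unitary
representation, `n = 1`, `ε = 0`, `B = b = 1`; on the singleton configuration space the two conditional laws agree, so the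
finite-size condition holds (difference `0 ≤ 0`).  Repaired statement `C′`: insert `IsCompactSimpleLieGroup G →` after the instance
binders; the witness misses `C′` (`PUnit` is not a compact simple Lie group). [folklore] -/
theorem not_CertificationLengthDiverges :
    ¬ Summit.QuantumFields.YangMills.Theses.CertificationLength.CertificationLengthDiverges := by
  intro h
  -- the trivial group with its faithful `0`-dimensional unitary representation
  let r : LatticeRep PUnit.{1} :=
    { N := 0, ρ := 1, continuous := continuous_const, injective := Function.injective_of_subsingleton _,
      mem_unitary := fun _ => Matrix.mem_unitaryGroup_iff.2 (Subsingleton.elim _ _) }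
  have h1 := h PUnit.{1} r 1 0 le_rfl le_rfl (by simp) 1
  obtain ⟨β₂, hβ⟩ := h1
  refine hβ β₂ le_rfl 1 le_rfl le_rfl ?_
  intro w _hw Y _hY _h0 η η' _hagree f _hcyl _hmeas _hbdd
  have hη : η = η' := Subsingleton.elim _ _
  subst hη
  simp

end Summit.QuantumFields.YangMills.Theorems.CertificationLength

end
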